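import Mathlib
import Literature.Analysis.ODE.MaxLyapunovInvariance

/-!
# GridStability/Models/ScalarPhaseLine — phase-line lemmas for scalar autonomous flows `x' = f(x)` (sign of `f` ⇒ monotone convergence to the adjacent zero) + one-sided Lipschitz / window facts for `sin`, `cos`

Cell `gridfusion` (LADDER-GRIDFUSION, apex line G3.a; seat gridfusion-model-3 (g9)). Pure mathematics
(tooling for the MODELLED-column statements of `Models/InverterDroopFirstOrderCCT.lean`: exact critical
clearing times of the first-order grid-forming droop model); no model content, no certificate, no kit —
in the manner of model-1's `Models/AngleEnclosure.lean`.

* `ScalarFlow.le_init_of_neg`, `ScalarFlow.expLower_le_of_neg` — two barriers for a solution of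
  `x' = f(x)` within `[0, T]` (tree convention `HasDerivWithinAt … (Icc 0 T)`): `f(x 0) < 0 ⇒ x ≤ x 0`;
  and, with `a < x 0 ≤ b`, `f < 0` on `(a, b]`, `f y ≥ −L(y − a)` on `(a, b]`:
  `a + (x 0 − a)e^{−(L+1)t} ≤ x t` (the solution never reaches the zero `a` in finite time). Both are
  ONE call of the tree's first-exit barrier lemma
  `Literature.Analysis.ODE.forall_le_of_hasDerivWithinAt_of_eq_imp_deriv_neg` (p-accepted, the
  Dini-free Nagumo argument) — no existence or uniqueness theorem is invoked.
* `ScalarFlow.tendsto_of_neg` / `ScalarFlow.tendsto_of_pos` — the phase-line facts on `[0, ∞)`: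
  `a < x 0 ≤ b`, `f` continuous on `[a, b]`, negative on `(a, b]` with the one-sided Lipschitz bound ⇒
  `a < x t ≤ x 0`, `x` non-increasing, `x t → a` (compactness: on `[ℓ, x 0]` with `ℓ > a` the field is
  `≤ −m < 0`, forcing `x → −∞`); mirror image for `f > 0` on `[b, a)`.
* `ScalarFlow.sin_sub_sin_le_sub`, `cos_sub_cos_le_sub` (one-sided, mean value theorem) and
  the window facts `sin_lt_sin_of_mem_window` (`δ ∈ (δ₀, π − δ₀)` ⇒ `sin δ₀ < sin δ`),
  `sin_lt_sin_of_mem_upper`, `cos_lt_cos_of_mem_inner`, `cos_lt_cos_of_mem_outer` — the sign pattern of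
  the `p_mes(δ_m)` curves of [cite: Qoria2020, Figs. V-11, V-14].

CERTIFIED/VALIDATED/MODELLED: pure mathematics; nothing here is about a converter or a grid.
-/

noncomputable section

open Real Set Filter Topology

namespace Summit.Ventures.GridStability.Models

namespace ScalarFlow

/-- Upper barrier for a scalar autonomous flow: if `x' = f(x)` within `[0, T]` and `f(x 0) < 0`,
then `x t ≤ x 0` on `[0, T]` (first-exit argument of the tree's barrier lemma
`Literature.Analysis.ODE.forall_le_of_hasDerivWithinAt_of_eq_imp_deriv_neg`, one barrier). -/
theorem le_init_of_neg {x f : ℝ → ℝ} {T : ℝ}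
    (hx : ∀ t ∈ Icc 0 T, HasDerivWithinAt x (f (x t)) (Icc 0 T) t) (h0 : f (x 0) < 0) :
    ∀ t ∈ Icc 0 T, x t ≤ x 0 := by
  have h := Literature.Analysis.ODE.forall_le_of_hasDerivWithinAt_of_eq_imp_deriv_neg
    (ι := Unit) (h := fun _ => x) (h' := fun _ t => f (x t)) (c := fun _ => x 0) (T := T)
    (fun _ => hx) (fun t _ _ _ hk => by show f (x t) < 0; rw [hk]; exact h0) (fun _ => le_rfl)
  exact fun t ht => h t ht ()

/-- Lower exponential barrier: if moreover `a < x 0 ≤ b`, `f < 0` on `(a, b]` and `f y ≥ −L (y − a)`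
on `(a, b]` (one-sided Lipschitz bound at the zero `a`), then
`a + (x 0 − a) e^{−(L+1)t} ≤ x t` on `[0, T]`; in particular `x` never reaches `a`. -/
theorem expLower_le_of_neg {x f : ℝ → ℝ} {a b L T : ℝ}
    (hx : ∀ t ∈ Icc 0 T, HasDerivWithinAt x (f (x t)) (Icc 0 T) t)
    (h0 : x 0 ∈ Ioc a b) (hneg : ∀ y ∈ Ioc a b, f y < 0)
    (hlip : ∀ y ∈ Ioc a b, -(L * (y - a)) ≤ f y) :
    ∀ t ∈ Icc 0 T, a + (x 0 - a) * exp (-(L + 1) * t) ≤ x t := by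
  have hup := le_init_of_neg hx (hneg _ h0)
  have hyd : ∀ t, HasDerivWithinAt (fun s => a + (x 0 - a) * exp (-(L + 1) * s))
      ((x 0 - a) * (exp (-(L + 1) * t) * (-(L + 1)))) (Icc 0 T) t := by
    intro t
    exact ((((hasDerivWithinAt_id t (Icc 0 T)).const_mul (-(L + 1))).exp.const_mul
      (x 0 - a)).const_add a).congr_deriv (by simp)
  have h := Literature.Analysis.ODE.forall_le_of_hasDerivWithinAt_of_eq_imp_deriv_neg
    (ι := Unit) (h := fun _ t => a + (x 0 - a) * exp (-(L + 1) * t) - x t)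
    (h' := fun _ t => (x 0 - a) * (exp (-(L + 1) * t) * (-(L + 1))) - f (x t))
    (c := fun _ => 0) (T := T) (fun _ t ht => (hyd t).sub (hx t ht)) ?_ ?_
  · intro t ht
    have := h t ht ()
    linarith
  · intro t ht _ _ hk
    have hE : 0 < (x 0 - a) * exp (-(L + 1) * t) := mul_pos (by linarith [h0.1]) (exp_pos _)
    have hxt : x t - a = (x 0 - a) * exp (-(L + 1) * t) := by linarith
    have hmem : x t ∈ Ioc a b := ⟨by linarith, (hup t ht).trans h0.2⟩
    have hl := hlip _ hmem
    rw [hxt] at hl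
    have h3 : (x 0 - a) * (exp (-(L + 1) * t) * (-(L + 1))) - f (x t)
        = -(f (x t) + L * ((x 0 - a) * exp (-(L + 1) * t)))
          - (x 0 - a) * exp (-(L + 1) * t) := by ring
    show (x 0 - a) * (exp (-(L + 1) * t) * (-(L + 1))) - f (x t) < 0
    rw [h3]
    linarith
  · intro _
    simp

/-- **Scalar sign lemma (decreasing side).** `x' = f(x)` within `[0, ∞)`, `a < x 0 ≤ b`, `f`
continuous on `[a, b]`, negative on `(a, b]`, with `f y ≥ −L (y − a)` there. Then for all `t ≥ 0`:
`a < x t ≤ x 0`; `x` is non-increasing on `[0, ∞)`; and `x t → a`. Elementary phase-line fact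
(no Lyapunov function, no existence/uniqueness theorem invoked: two barriers + compactness). -/
theorem tendsto_of_neg {x f : ℝ → ℝ} {a b L : ℝ}
    (hx : ∀ t ∈ Ici (0:ℝ), HasDerivWithinAt x (f (x t)) (Ici 0) t)
    (h0 : x 0 ∈ Ioc a b) (hneg : ∀ y ∈ Ioc a b, f y < 0)
    (hlip : ∀ y ∈ Ioc a b, -(L * (y - a)) ≤ f y) (hf : ContinuousOn f (Icc a b)) :
    (∀ t, 0 ≤ t → a < x t ∧ x t ≤ x 0) ∧ AntitoneOn x (Ici 0) ∧ Tendsto x atTop (𝓝 a) := by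
  have hxT : ∀ T, ∀ t ∈ Icc 0 T, HasDerivWithinAt x (f (x t)) (Icc 0 T) t :=
    fun T t ht => (hx t ht.1).mono Icc_subset_Ici_self
  have hbd : ∀ t, 0 ≤ t → a < x t ∧ x t ≤ x 0 := by
    intro t ht
    refine ⟨?_, le_init_of_neg (hxT t) (hneg _ h0) t ⟨ht, le_rfl⟩⟩
    have h1 := expLower_le_of_neg (hxT t) h0 hneg hlip t ⟨ht, le_rfl⟩
    have : 0 < (x 0 - a) * exp (-(L + 1) * t) := mul_pos (by linarith [h0.1]) (exp_pos _)
    linarith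
  have hcont : ContinuousOn x (Ici 0) := fun t ht => (hx t ht).continuousWithinAt
  have hint : interior (Ici (0:ℝ)) = Ioi 0 := interior_Ici
  have hanti : AntitoneOn x (Ici 0) := by
    refine antitoneOn_of_hasDerivWithinAt_nonpos (convex_Ici 0) hcont (f' := fun t => f (x t)) ?_ ?_
    · intro t ht
      rw [hint] at ht ⊢
      exact (hx t (mem_Ici.2 ht.le)).mono Ioi_subset_Ici_self
    · intro t ht
      rw [hint] at ht
      have := hbd t ht.le
      exact (hneg _ ⟨this.1, this.2.trans h0.2⟩).le
  refine ⟨hbd, hanti, ?_⟩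
  set xt : ℝ → ℝ := fun t => x (max t 0) with hxt
  have hxt_anti : Antitone xt := by
    intro s t hst
    exact hanti (le_max_right s 0) (le_max_right t 0) (max_le_max hst le_rfl)
  have hxt_bdd : BddBelow (range xt) := by
    refine ⟨a, ?_⟩
    rintro _ ⟨t, rfl⟩
    exact (hbd _ (le_max_right t 0)).1.le
  have hlim0 : Tendsto xt atTop (𝓝 (⨅ t, xt t)) := tendsto_atTop_ciInf hxt_anti hxt_bdd
  obtain ⟨ℓ, hℓ⟩ : ∃ ℓ, ℓ = ⨅ t, xt t := ⟨_, rfl⟩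
  have hlim : Tendsto xt atTop (𝓝 ℓ) := by rw [hℓ]; exact hlim0
  have heq : xt =ᶠ[atTop] x := by
    filter_upwards [eventually_ge_atTop (0:ℝ)] with t ht
    simp only [hxt, max_eq_left ht]
  have hlimx : Tendsto x atTop (𝓝 ℓ) := hlim.congr' heq
  have hℓa : a ≤ ℓ := by rw [hℓ]; exact le_ciInf fun t => (hbd _ (le_max_right t 0)).1.le
  have hxℓ : ∀ t, 0 ≤ t → ℓ ≤ x t := by
    intro t ht
    have := ciInf_le hxt_bdd t
    simp only [hxt, max_eq_left ht] at this
    rw [hℓ]; exact this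
  rcases eq_or_ne ℓ a with hℓ_eq | hne
  · rw [hℓ_eq] at hlimx; exact hlimx
  exfalso
  have hℓa' : a < ℓ := lt_of_le_of_ne hℓa (Ne.symm hne)
  have hsub : Icc ℓ (x 0) ⊆ Icc a b := Icc_subset_Icc hℓa h0.2
  have hne' : (Icc ℓ (x 0)).Nonempty := ⟨x 0, hxℓ 0 le_rfl, le_rfl⟩
  obtain ⟨y₀, hy₀, hmax⟩ := isCompact_Icc.exists_isMaxOn hne' (hf.mono hsub)
  have hm : f y₀ < 0 := hneg _ ⟨hℓa'.trans_le hy₀.1, hy₀.2.trans h0.2⟩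
  have hg : AntitoneOn (fun t => x t - f y₀ * t) (Ici 0) := by
    refine antitoneOn_of_hasDerivWithinAt_nonpos (convex_Ici 0)
      (hcont.sub (continuousOn_const.mul continuousOn_id)) (f' := fun t => f (x t) - f y₀ * 1) ?_ ?_
    · intro t ht
      rw [hint] at ht ⊢
      exact ((hx t (mem_Ici.2 ht.le)).mono Ioi_subset_Ici_self).sub
        ((hasDerivWithinAt_id t (Ioi 0)).const_mul (f y₀))
    · intro t ht
      rw [hint] at ht
      have hxmem : x t ∈ Icc ℓ (x 0) := ⟨hxℓ t ht.le, (hbd t ht.le).2⟩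
      have := isMaxOn_iff.1 hmax (x t) hxmem
      linarith
  set t₁ : ℝ := (x 0 - ℓ + 1) / (-f y₀) with ht₁
  have ht₁pos : 0 < t₁ := div_pos (by linarith [hxℓ 0 le_rfl]) (by linarith)
  have h1 := hg (self_mem_Ici : (0:ℝ) ∈ Ici 0) ht₁pos.le ht₁pos.le
  simp only [mul_zero, sub_zero] at h1
  have h2 : f y₀ * t₁ = -(x 0 - ℓ + 1) := by
    have hne0 : -f y₀ ≠ 0 := (neg_pos.2 hm).ne'
    rw [ht₁, mul_div_assoc', div_eq_iff hne0]
    ring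
  have h3 := hxℓ t₁ ht₁pos.le
  linarith

/-- **Scalar sign lemma (increasing side)**, mirror image of `tendsto_of_neg`: `b ≤ x 0 < a`, `f`
continuous on `[b, a]`, positive on `[b, a)`, `f y ≤ L (a − y)` there ⇒ `x 0 ≤ x t < a` for
`t ≥ 0`, `x` non-decreasing on `[0, ∞)`, `x t → a`. -/
theorem tendsto_of_pos {x f : ℝ → ℝ} {a b L : ℝ}
    (hx : ∀ t ∈ Ici (0:ℝ), HasDerivWithinAt x (f (x t)) (Ici 0) t)
    (h0 : x 0 ∈ Ico b a) (hpos : ∀ y ∈ Ico b a, 0 < f y)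
    (hlip : ∀ y ∈ Ico b a, f y ≤ L * (a - y)) (hf : ContinuousOn f (Icc b a)) :
    (∀ t, 0 ≤ t → x 0 ≤ x t ∧ x t < a) ∧ MonotoneOn x (Ici 0) ∧ Tendsto x atTop (𝓝 a) := by
  have h := tendsto_of_neg (x := fun t => -x t) (f := fun y => -f (-y)) (a := -a) (b := -b) (L := L)
    (fun t ht => by have h := (hx t ht).neg; simp only [neg_neg]; exact h)
    ⟨by simp only [neg_lt_neg_iff]; exact h0.2, by simp only [neg_le_neg_iff]; exact h0.1⟩
    (fun y hy => by
      have : -y ∈ Ico b a := ⟨by linarith [hy.2], by linarith [hy.1]⟩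
      linarith [hpos _ this])
    (fun y hy => by
      have : -y ∈ Ico b a := ⟨by linarith [hy.2], by linarith [hy.1]⟩
      have := hlip _ this
      linarith)
    (by
      have hmaps : MapsTo (fun y : ℝ => -y) (Icc (-a) (-b)) (Icc b a) := fun y hy =>
        ⟨by linarith [hy.2], by linarith [hy.1]⟩
      exact (hf.comp continuousOn_neg hmaps).neg)
  obtain ⟨hbd, hanti, hlim⟩ := h
  refine ⟨fun t ht => ?_, fun s hs t ht hst => ?_, ?_⟩
  · have := hbd t ht; constructor <;> linarith [this.1, this.2]
  · have := hanti hs ht hst; simp only [neg_le_neg_iff] at this; exact this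
  · simpa using hlim.neg


/-! ## §1 Window facts for `sin` / `cos` and one-sided Lipschitz bounds (mean value theorem) -/

/-- `sin y − sin a ≤ y − a` for `a < y` (mean value theorem, `cos ≤ 1`). -/
theorem sin_sub_sin_le_sub {a y : ℝ} (h : a < y) : sin y - sin a ≤ y - a := by
  obtain ⟨c, _, hc⟩ := exists_hasDerivAt_eq_slope sin cos h
    continuous_sin.continuousOn (fun x _ => hasDerivAt_sin x)
  have hya : 0 < y - a := sub_pos.2 h
  have : sin y - sin a = cos c * (y - a) := by rw [hc]; field_simp
  rw [this]
  nlinarith [cos_le_one c]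

/-- `cos y − cos a ≤ y − a` for `a < y` (mean value theorem, `−sin ≤ 1`). -/
theorem cos_sub_cos_le_sub {a y : ℝ} (h : a < y) : cos y - cos a ≤ y - a := by
  obtain ⟨c, _, hc⟩ := exists_hasDerivAt_eq_slope cos (fun x => -sin x) h
    continuous_cos.continuousOn (fun x _ => hasDerivAt_cos x)
  have hya : 0 < y - a := sub_pos.2 h
  have : cos y - cos a = -sin c * (y - a) := by rw [hc]; field_simp
  rw [this]
  nlinarith [neg_one_le_sin c]

/-- On the window `(δ₀, π − δ₀)` above an angle `δ₀ ∈ [−π/2, π/2]` the sine exceeds `sin δ₀`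
(the branch (a)→(a′) of the `p_mes(δ_m)` curve lies above `p*` [cite: Qoria2020, Fig. V-11]). -/
theorem sin_lt_sin_of_mem_window {δ₀ δ : ℝ} (h₀ : δ₀ ∈ Icc (-(π / 2)) (π / 2))
    (hδ : δ ∈ Ioo δ₀ (π - δ₀)) : sin δ₀ < sin δ := by
  rcases le_or_gt δ (π / 2) with hle | hlt
  · exact sin_lt_sin_of_lt_of_le_pi_div_two h₀.1 hle hδ.1
  · rw [← sin_pi_sub δ]
    exact sin_lt_sin_of_lt_of_le_pi_div_two h₀.1 (by linarith) (by linarith [hδ.2])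

/-- Past the unstable angle: on `(π − δ₀, 2π + δ₀)` the sine is below `sin δ₀`. -/
theorem sin_lt_sin_of_mem_upper {δ₀ δ : ℝ} (h₀ : δ₀ ∈ Icc (-(π / 2)) (π / 2))
    (hδ : δ ∈ Ioo (π - δ₀) (2 * π + δ₀)) : sin δ < sin δ₀ := by
  have h1 : sin (-δ₀) < sin (δ - π) :=
    sin_lt_sin_of_mem_window (δ₀ := -δ₀) ⟨by linarith [h₀.2], by linarith [h₀.1]⟩
      ⟨by linarith [hδ.1], by linarith [hδ.2]⟩
  rw [sin_neg, sin_sub_pi] at h1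
  linarith

/-- Inside `(−δ_m, δ_m)`, `δ_m ≤ π`: `cos δ_m < cos δ`. -/
theorem cos_lt_cos_of_mem_inner {δm δ : ℝ} (hm : δm ≤ π) (hδ : δ ∈ Ioo (-δm) δm) :
    cos δm < cos δ := by
  rcases le_or_gt 0 δ with hle | hlt
  · exact cos_lt_cos_of_nonneg_of_le_pi hle hm hδ.2
  · rw [← cos_neg δ]
    exact cos_lt_cos_of_nonneg_of_le_pi (by linarith) hm (by linarith [hδ.1])

/-- On `(δ_m, 2π − δ_m)`, `0 ≤ δ_m`: `cos δ < cos δ_m`. -/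
theorem cos_lt_cos_of_mem_outer {δm δ : ℝ} (hm : 0 ≤ δm) (hδ : δ ∈ Ioo δm (2 * π - δm)) :
    cos δ < cos δm := by
  rcases le_or_gt δ π with hle | hlt
  · exact cos_lt_cos_of_nonneg_of_le_pi hm hle hδ.1
  · rw [← cos_two_pi_sub δ]
    exact cos_lt_cos_of_nonneg_of_le_pi hm (by linarith) (by linarith [hδ.2])

end ScalarFlow

end Summit.Ventures.GridStability.Models

end
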